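import Literature.NumberTheory.GaloisRepresentations.IdeleClassQuotientLayerVanishing
import Literature.Algebra.Homology.ClassModuleInvariant
import HarnessLib

/-!
# The invariant map of an `S`-idèle class layer `C_S(E) = C_E / U_{E,S}`:
# `inv_{E/F,S} : H²(Gal(E/F), C_S(E)) ⥲ (1/[E:F])ℤ/ℤ`, THE class `ū_{E/F} = H²(π) u_{E/F}` and the relative
# invariants at `H ≤ Gal(E/F)` (Harari Def. 16.3 / Thm. 17.2; Milne ADT I §1, §4; Serre XI §2–§3)

Topic `NumberTheory/GaloisRepresentations`; namespace `Literature.NumberTheory.GaloisRepresentations.IdeleCohomology`.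
Definitions with bodies (`fundamentalClassModUnits`, `classModUnitsCocycle`, `classModUnitsInv`) and theorems; NO named
fact, no `sorry`, no instance, no notation; number fields in `Type`.  Sequel of `IdeleClassModUnitsSClassModule`
(`groupCohomologyClassModUnitsIsoTop S hS n : Hⁿ(Gal(E/F), C_E) ≅ Hⁿ(Gal(E/F), C_S(E))` and
`groupCohomologyClassModUnitsIso S hS H n : Hⁿ(H, C_E) ≅ Hⁿ(H, C_S(E))` for `n ≥ 1`, `S ⊇` the places ramified in `E/F`),
`IdeleClassQuotientLayerVanishing` (seat w4 g19: `isClassModule_classModUnits_of_H2π_eq` — `C_S(E)` is a class module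
with the class `H²(π) u_{E/F}`), the tree's `IdeleClassInvariant` / `IdeleClassFundamentalClassTower` (door-c5/door-c6:
`classInvAll F E : H²(Gal(E/F), C_E) →+ ℚ/ℤ` injective with image `(1/[E:F])ℤ/ℤ`, THE class `fundamentalClassAll F E`)
and the engine `Algebra/Homology/ClassModuleInvariant` (door-c4 g16: `IsClassModule.inv / invSub`,
`inv_H ∘ res_H = [G:H] · inv_G`).

THE POINT.  Harari (Def. 15.38, Thm. 17.2; Milne ADT I §4; NSW (8.3.8)–(8.3.10)): the `S`-idèle class formation
`(G_S, C_S = lim→_{E ⊂ F_S} C_S(E))`, `C_S(E) = C_E / U_{E,S}`, is a `P`-class formation whose invariant map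
`inv_S : H²(G_S, C_S) ↪ ℚ/ℤ` is, LAYER BY LAYER, the idèle-class invariant read through `H²(Gal(E/F), C_E) ⥲
H²(Gal(E/F), C_S(E))` (`U_{E,S}` is cohomologically trivial for `S ⊇` the places ramified in `E/F`, Prop. 15.40).
This file is the finite-layer half in the tree's `classModUnitsRep` currency (limit over `E ⊂ F_S` and tower law are
sequels): §1 THE class `ū_{E/F} := H²(π) u_{E/F}` (`fundamentalClassModUnits`), a representing cocycle, its class-module
structure, `addOrderOf ū_{E/F} = [E:F]`; §2 THE invariant map `classModUnitsInv S hS := inv_{E/F} ∘ (H²(π))⁻¹`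
(`inv_S (H²(π) α) = inv_{E/F} α`, value `1/[E:F]` on `ū_{E/F}`, injective, image `(1/[E:F])ℤ/ℤ`, uniqueness;
**`inv_classModUnitsCocycle_apply`**: the engine's class-module invariant IS `inv_S`); §3 the relative invariants
`invSub H` at `H ≤ Gal(E/F)` (`inv_H ∘ res_H = [G:H] · inv_S`, values `r/|H|`; **`invSub_classModUnits_iso_hom`**: along
`H²(H, C_E) ⥲ H²(H, C_S(E))` the relative `S`-invariant IS the relative idèle-class invariant); §4 the ranges as
`{q : n • q = 0}` (the form the `P`-class-formation engine reads).

Cell `bsd-eis`, background lane «PT-Ш-S-TC» of crux `GoodLatticeBDPValue` (stmt-BirchSwinnertonDyer-19032), brick D2-CF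
(the invariant maps of `TateDualityHypothesesAt p (C̄_S) inv_S`), seat bsd-line-x1-p1-w5 g10.  HONEST FRAMING: class
field theory bookkeeping at a finite layer in the tree's normalisation; no duality theorem, no case of Poitou–Tate and
no case of BSD is proved here.

## References
* D. Harari, *Galois Cohomology and Class Field Theory*, Universitext (2020), Def. 15.38, Prop. 15.40, §16.1 Def. 16.3,
  §17.1 Thm. 17.2. [Harari2020]
* J. S. Milne, *Arithmetic Duality Theorems* (2nd ed. 2006), I §1 (class formations), I §4 (`(G_S, C_S)`). [MilneADT2006]
* J. Neukirch, A. Schmidt, K. Wingberg, *Cohomology of Number Fields* (2nd ed. 2008), VIII §3 (8.3.8)–(8.3.10).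
  [NeukirchSchmidtWingberg2008]
* J.-P. Serre, *Local Fields*, GTM 67 (1979), XI §2 Prop. 1, §3. [SerreLocalFields1979]
-/

noncomputable section

open NumberField IsDedekindDomain CategoryTheory CategoryTheory.Limits groupCohomology
open Literature.NumberTheory.Automorphic Literature.Algebra.Homology
open Literature.AnabelianGeometry.AbsoluteAnabelian.Prop121vii (zmodToQmodZ)

namespace Literature.NumberTheory.GaloisRepresentations

namespace IdeleCohomology

variable {F : Type} [Field F] [NumberField F] {E : Type} [Field E] [NumberField E] [Algebra F E] [IsGalois F E]
  (S : Finset (HeightOneSpectrum (𝓞 F)))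

/-! ## §1. THE class `ū_{E/F} = H²(π) u_{E/F}` of `C_S(E)` and its class-module structure -/

variable (F E) in
/-- **THE fundamental class `ū_{E/F} ∈ H²(Gal(E/F), C_S(E))` of the `S`-idèle class layer**: the image of the canonical
fundamental class `u_{E/F} ∈ H²(Gal(E/F), C_E)` under `H²(C_E ↠ C_S(E))`.
[cite: Harari2020, §17.1 Thm. 17.2][cite: NeukirchSchmidtWingberg2008, VIII §3 (8.3.8)] -/
def fundamentalClassModUnits : groupCohomology (classModUnitsRep F E S) 2 :=
  map (MonoidHom.id (E ≃ₐ[F] E)) (cokernel.π (unitsOffToClass (F := F) (E := E) S)) 2 (fundamentalClassAll F E)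

variable (F E) in
/-- **A 2-cocycle representing `ū_{E/F}`** (chosen once and for all). [cite: Harari2020, §17.1 Thm. 17.2] -/
def classModUnitsCocycle : cocycles₂ (classModUnitsRep F E S) :=
  (show ∃ ψ : cocycles₂ (classModUnitsRep F E S), H2π (classModUnitsRep F E S) ψ = fundamentalClassModUnits F E S by
    induction fundamentalClassModUnits F E S using H2_induction_on with
    | h ψ => exact ⟨ψ, rfl⟩).choose

/-- `[classModUnitsCocycle] = ū_{E/F}`. [cite: Harari2020, §17.1 Thm. 17.2] -/
theorem H2π_classModUnitsCocycle :
    H2π (classModUnitsRep F E S) (classModUnitsCocycle F E S) = fundamentalClassModUnits F E S :=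
  (show ∃ ψ : cocycles₂ (classModUnitsRep F E S), H2π (classModUnitsRep F E S) ψ = fundamentalClassModUnits F E S by
    induction fundamentalClassModUnits F E S using H2_induction_on with
    | h ψ => exact ⟨ψ, rfl⟩).choose_spec

/-- **`(Gal(E/F), C_S(E))` is a class module with THE class `ū_{E/F}`** when `S` contains the places ramified in `E/F`
(w4 g19's `isClassModule_classModUnits_of_H2π_eq` on the chosen cocycle).
[cite: Harari2020, §17.1 Thm. 17.2][cite: NeukirchSchmidtWingberg2008, VIII §3 (8.3.10)] -/
theorem isClassModule_classModUnitsCocycle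
    (hS : ∀ v : HeightOneSpectrum (𝓞 F), v ∉ S → Algebra.IsUnramifiedIn (𝓞 E) v.asIdeal) :
    IsClassModule (classModUnitsRep F E S) (classModUnitsCocycle F E S) :=
  isClassModule_classModUnits_of_H2π_eq S hS (ψ := classModUnitsCocycle F E S) (by rw [H2π_classModUnitsCocycle]; rfl)

omit [NumberField F] [NumberField E] [IsGalois F E] in
/-- `Gal(E/F)` is finite (instance-free form for the engine's `[Finite G]`). [cite: Harari2020, §17.1 Thm. 17.2] -/
theorem finite_gal [FiniteDimensional F E] : Finite (E ≃ₐ[F] E) := inferInstance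

/-- **`ū_{E/F}` has order `[E:F]`**, i.e. generates the cyclic group `H²(Gal(E/F), C_S(E))` of order `[E:F]`.
[cite: Harari2020, §17.1 Thm. 17.2] -/
theorem addOrderOf_fundamentalClassModUnits
    (hS : ∀ v : HeightOneSpectrum (𝓞 F), v ∉ S → Algebra.IsUnramifiedIn (𝓞 E) v.asIdeal) :
    addOrderOf (fundamentalClassModUnits F E S) = Module.finrank F E := by
  rw [← H2π_classModUnitsCocycle S, (isClassModule_classModUnitsCocycle S hS).addOrderOf_H2π,
    IsGalois.card_aut_eq_finrank]

/-- **`H²(Gal(E/F), C_S(E)) = ℤ · ū_{E/F}`**: every class is an integer multiple of THE class.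
[cite: Harari2020, §17.1 Thm. 17.2] -/
theorem exists_zsmul_fundamentalClassModUnits_eq
    (hS : ∀ v : HeightOneSpectrum (𝓞 F), v ∉ S → Algebra.IsUnramifiedIn (𝓞 E) v.asIdeal)
    (x : groupCohomology (classModUnitsRep F E S) 2) : ∃ r : ℤ, r • fundamentalClassModUnits F E S = x := by
  rw [← H2π_classModUnitsCocycle S]
  exact (isClassModule_classModUnitsCocycle S hS).exists_zsmul_H2π_eq x

/-! ## §2. THE invariant map `inv_{E/F,S} : H²(Gal(E/F), C_S(E)) →+ ℚ/ℤ` -/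

/-- **The isomorphism `H²(π) : H²(Gal(E/F), C_E) ⥲ H²(Gal(E/F), C_S(E))` maps `u_{E/F}` to `ū_{E/F}`** (definitional).
[cite: Harari2020, §17.1 Thm. 17.2 (proof)] -/
theorem groupCohomologyClassModUnitsIsoTop_hom_fundamentalClassAll
    (hS : ∀ v : HeightOneSpectrum (𝓞 F), v ∉ S → Algebra.IsUnramifiedIn (𝓞 E) v.asIdeal) :
    (groupCohomologyClassModUnitsIsoTop S hS 2).hom (fundamentalClassAll F E) = fundamentalClassModUnits F E S := rfl

/-- The isomorphism `Hⁿ(π)` on elements is `groupCohomology.map` of `C_E ↠ C_S(E)` (definitional).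
[cite: Harari2020, §17.1 Thm. 17.2 (proof)] -/
theorem groupCohomologyClassModUnitsIsoTop_hom_apply
    (hS : ∀ v : HeightOneSpectrum (𝓞 F), v ∉ S → Algebra.IsUnramifiedIn (𝓞 E) v.asIdeal) (n : ℕ) [NeZero n]
    (α : groupCohomology (IdeleClassGroup.galoisRep F E) n) :
    (groupCohomologyClassModUnitsIsoTop S hS n).hom α =
      map (MonoidHom.id (E ≃ₐ[F] E)) (cokernel.π (unitsOffToClass (F := F) (E := E) S)) n α := rfl

/-- **THE invariant map of the `S`-idèle class layer**, `inv_{E/F,S} := inv_{E/F} ∘ (H²(Gal(E/F), C_E) ⥲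
H²(Gal(E/F), C_S(E)))⁻¹` (`S ⊇` the places ramified in `E/F`): the invariant map of the `P`-class formation
`(G_S, C_S)` at the finite layer `E`.  [cite: Harari2020, §16.1 Def. 16.3, §17.1 Thm. 17.2][cite: MilneADT2006, I §4] -/
def classModUnitsInv (hS : ∀ v : HeightOneSpectrum (𝓞 F), v ∉ S → Algebra.IsUnramifiedIn (𝓞 E) v.asIdeal) :
    groupCohomology (classModUnitsRep F E S) 2 →+ AddCircle (1 : ℚ) :=
  (classInvAll F E).comp (groupCohomologyClassModUnitsIsoTop S hS 2).inv.hom.toAddMonoidHom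

/-- Formula: `inv_S x = inv_{E/F} ((H²(π))⁻¹ x)`. [cite: Harari2020, §17.1 Thm. 17.2] -/
theorem classModUnitsInv_apply
    (hS : ∀ v : HeightOneSpectrum (𝓞 F), v ∉ S → Algebra.IsUnramifiedIn (𝓞 E) v.asIdeal)
    (x : groupCohomology (classModUnitsRep F E S) 2) :
    classModUnitsInv S hS x = classInvAll F E ((groupCohomologyClassModUnitsIsoTop S hS 2).inv x) := rfl

/-- **`inv_S (H²(π) α) = inv_{E/F} (α)`**: on a class coming from `C_E` the `S`-invariant is the idèle-class invariant.
[cite: Harari2020, §17.1 Thm. 17.2][cite: MilneADT2006, I §4] -/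
theorem classModUnitsInv_iso_hom
    (hS : ∀ v : HeightOneSpectrum (𝓞 F), v ∉ S → Algebra.IsUnramifiedIn (𝓞 E) v.asIdeal)
    (α : groupCohomology (IdeleClassGroup.galoisRep F E) 2) :
    classModUnitsInv S hS ((groupCohomologyClassModUnitsIsoTop S hS 2).hom α) = classInvAll F E α := by
  rw [classModUnitsInv_apply, ← ModuleCat.comp_apply, Iso.hom_inv_id, ModuleCat.id_apply]

/-- The same in the `groupCohomology.map` spelling. [cite: Harari2020, §17.1 Thm. 17.2] -/
theorem classModUnitsInv_map_π
    (hS : ∀ v : HeightOneSpectrum (𝓞 F), v ∉ S → Algebra.IsUnramifiedIn (𝓞 E) v.asIdeal)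
    (α : groupCohomology (IdeleClassGroup.galoisRep F E) 2) :
    classModUnitsInv S hS (map (MonoidHom.id (E ≃ₐ[F] E)) (cokernel.π (unitsOffToClass (F := F) (E := E) S)) 2 α) =
      classInvAll F E α :=
  classModUnitsInv_iso_hom S hS α

/-- **`inv_S (ū_{E/F}) = 1/[E:F]`.** [cite: Harari2020, §17.1 Thm. 17.2][cite: SerreLocalFields1979, Ch. XI §3] -/
theorem classModUnitsInv_fundamentalClassModUnits
    (hS : ∀ v : HeightOneSpectrum (𝓞 F), v ∉ S → Algebra.IsUnramifiedIn (𝓞 E) v.asIdeal) :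
    classModUnitsInv S hS (fundamentalClassModUnits F E S) =
      (haveI := neZero_finrank F E; zmodToQmodZ (Module.finrank F E) 1) := by
  rw [← groupCohomologyClassModUnitsIsoTop_hom_fundamentalClassAll S hS, classModUnitsInv_iso_hom]
  exact classInvAll_fundamentalClassAll F E

/-- **`inv_S` is injective** (`inv_{E/F}` is, and `H²(π)` is an isomorphism).
[cite: Harari2020, §17.1 Thm. 17.2][cite: MilneADT2006, I §4] -/
theorem classModUnitsInv_injective
    (hS : ∀ v : HeightOneSpectrum (𝓞 F), v ∉ S → Algebra.IsUnramifiedIn (𝓞 E) v.asIdeal) :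
    Function.Injective (classModUnitsInv S hS) := by
  intro x x' h
  rw [classModUnitsInv_apply, classModUnitsInv_apply] at h
  have h' := classInvAll_injective F E h
  have := congrArg (groupCohomologyClassModUnitsIsoTop S hS 2).hom h'
  rwa [← ModuleCat.comp_apply, ← ModuleCat.comp_apply, Iso.inv_hom_id, ModuleCat.id_apply, ModuleCat.id_apply] at this

/-- `inv_S x = 0 ↔ x = 0`. [cite: Harari2020, §17.1 Thm. 17.2] -/
theorem classModUnitsInv_eq_zero_iff
    (hS : ∀ v : HeightOneSpectrum (𝓞 F), v ∉ S → Algebra.IsUnramifiedIn (𝓞 E) v.asIdeal)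
    (x : groupCohomology (classModUnitsRep F E S) 2) : classModUnitsInv S hS x = 0 ↔ x = 0 :=
  ⟨fun h => classModUnitsInv_injective S hS (h.trans (map_zero _).symm), fun h => by rw [h, map_zero]⟩

/-- `[E:F] • inv_S (x) = 0`. [cite: Harari2020, §17.1 Thm. 17.2] -/
theorem finrank_nsmul_classModUnitsInv
    (hS : ∀ v : HeightOneSpectrum (𝓞 F), v ∉ S → Algebra.IsUnramifiedIn (𝓞 E) v.asIdeal)
    (x : groupCohomology (classModUnitsRep F E S) 2) : Module.finrank F E • classModUnitsInv S hS x = 0 := by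
  rw [classModUnitsInv_apply]
  exact finrank_nsmul_classInvAll F E _

/-- **The image of `inv_S` is exactly `(1/[E:F])ℤ/ℤ`** (that of `inv_{E/F}`).
[cite: Harari2020, §17.1 Thm. 17.2][cite: MilneADT2006, I §4] -/
theorem range_classModUnitsInv
    (hS : ∀ v : HeightOneSpectrum (𝓞 F), v ∉ S → Algebra.IsUnramifiedIn (𝓞 E) v.asIdeal) :
    Set.range (classModUnitsInv S hS) = Set.range (haveI := neZero_finrank F E; zmodToQmodZ (Module.finrank F E)) := by
  haveI := neZero_finrank F E
  rw [← range_classInvAll F E]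
  ext t
  constructor
  · rintro ⟨x, rfl⟩
    exact ⟨_, (classModUnitsInv_apply S hS x).symm⟩
  · rintro ⟨α, rfl⟩
    exact ⟨_, classModUnitsInv_iso_hom S hS α⟩

/-- A class with invariant `1/[E:F]` is `ū_{E/F}`. [cite: Harari2020, §17.1 Thm. 17.2] -/
theorem eq_fundamentalClassModUnits_of_classModUnitsInv_eq
    (hS : ∀ v : HeightOneSpectrum (𝓞 F), v ∉ S → Algebra.IsUnramifiedIn (𝓞 E) v.asIdeal)
    {x : groupCohomology (classModUnitsRep F E S) 2}
    (h : classModUnitsInv S hS x = (haveI := neZero_finrank F E; zmodToQmodZ (Module.finrank F E) 1)) :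
    x = fundamentalClassModUnits F E S :=
  classModUnitsInv_injective S hS (h.trans (classModUnitsInv_fundamentalClassModUnits S hS).symm)

/-- **Uniqueness**: an additive map `H²(Gal(E/F), C_S(E)) → ℚ/ℤ` agreeing with `inv_{E/F}` through `H²(π)` is `inv_S`.
[cite: Harari2020, §16.1 Def. 16.3] -/
theorem eq_classModUnitsInv_of_iso_hom
    (hS : ∀ v : HeightOneSpectrum (𝓞 F), v ∉ S → Algebra.IsUnramifiedIn (𝓞 E) v.asIdeal)
    (g : groupCohomology (classModUnitsRep F E S) 2 →+ AddCircle (1 : ℚ))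
    (hg : ∀ α : groupCohomology (IdeleClassGroup.galoisRep F E) 2,
      g ((groupCohomologyClassModUnitsIsoTop S hS 2).hom α) = classInvAll F E α) :
    g = classModUnitsInv S hS := by
  ext x
  obtain ⟨α, rfl⟩ : ∃ α, (groupCohomologyClassModUnitsIsoTop S hS 2).hom α = x :=
    ⟨(groupCohomologyClassModUnitsIsoTop S hS 2).inv x, by rw [← ModuleCat.comp_apply, Iso.inv_hom_id, ModuleCat.id_apply]⟩
  rw [hg, classModUnitsInv_iso_hom]

/-- **The engine's class-module invariant of `(Gal(E/F), C_S(E), ū_{E/F})` IS `inv_S`**: both are additive on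
`H²(Gal(E/F), C_S(E)) = ℤ · ū_{E/F}` with value `1/[E:F] = 1/|Gal(E/F)|` on `ū_{E/F}`.
[cite: Harari2020, §16.1 Def. 16.3, §17.1 Thm. 17.2][cite: SerreLocalFields1979, Ch. XI §3] -/
theorem inv_classModUnitsCocycle_apply
    (hS : ∀ v : HeightOneSpectrum (𝓞 F), v ∉ S → Algebra.IsUnramifiedIn (𝓞 E) v.asIdeal)
    (x : groupCohomology (classModUnitsRep F E S) 2) :
    (isClassModule_classModUnitsCocycle S hS).inv x = classModUnitsInv S hS x := by
  haveI := neZero_finrank F E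
  have h := (isClassModule_classModUnitsCocycle S hS).eq_inv_of_apply_H2π (classModUnitsInv S hS) (by
    rw [H2π_classModUnitsCocycle, IsGalois.card_aut_eq_finrank, classModUnitsInv_fundamentalClassModUnits S hS, oneDiv,
      UnitsLayer.zmodToQmodZ_one_eq])
  exact (DFunLike.congr_fun h x).symm

/-- `inv_S (r • ū_{E/F}) = r/[E:F]`. [cite: SerreLocalFields1979, Ch. XI §3] -/
theorem classModUnitsInv_zsmul_fundamentalClassModUnits
    (hS : ∀ v : HeightOneSpectrum (𝓞 F), v ∉ S → Algebra.IsUnramifiedIn (𝓞 E) v.asIdeal) (r : ℤ) :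
    classModUnitsInv S hS (r • fundamentalClassModUnits F E S) = r • oneDiv (Module.finrank F E) := by
  rw [← inv_classModUnitsCocycle_apply, ← H2π_classModUnitsCocycle S,
    (isClassModule_classModUnitsCocycle S hS).inv_zsmul_H2π, IsGalois.card_aut_eq_finrank]

/-! ## §3. The relative invariants at `H ≤ Gal(E/F)` -/

/-- The restricted class `res_H ū_{E/F} ∈ H²(H, C_S(E))` — the fundamental class of the class module `Res_H C_S(E)`.
[cite: SerreLocalFields1979, Ch. XI §3][cite: Neukirch2013, Part II §1 Prop. (1.6) b)] -/
abbrev resFundamentalClassModUnits (H : Subgroup (E ≃ₐ[F] E)) :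
    groupCohomology (Rep.res H.subtype (classModUnitsRep F E S)) 2 :=
  map H.subtype (𝟙 (Rep.res H.subtype (classModUnitsRep F E S))) 2 (fundamentalClassModUnits F E S)

/-- `res_H ū_{E/F} = res_H [classModUnitsCocycle]` (the engine's spelling of the restricted fundamental class).
[cite: SerreLocalFields1979, Ch. XI §3] -/
theorem resFundamentalClassModUnits_eq (H : Subgroup (E ≃ₐ[F] E)) :
    resFundamentalClassModUnits S H =
      map H.subtype (𝟙 (Rep.res H.subtype (classModUnitsRep F E S))) 2
        (H2π (classModUnitsRep F E S) (classModUnitsCocycle F E S)) := by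
  rw [H2π_classModUnitsCocycle]

/-- **`inv_H (res_H x) = [Gal(E/F) : H] · inv_S (x)`** — the `Res`-axiom of class formations for the `S`-idèle class
layer (Serre XI §2 Prop. 1; the engine's `invSub_map_subtype`). [cite: SerreLocalFields1979, Ch. XI §2 Prop. 1][cite: MilneADT2006, I §1] -/
theorem invSub_classModUnits_map_subtype
    (hS : ∀ v : HeightOneSpectrum (𝓞 F), v ∉ S → Algebra.IsUnramifiedIn (𝓞 E) v.asIdeal)
    (H : Subgroup (E ≃ₐ[F] E)) (x : groupCohomology (classModUnitsRep F E S) 2) :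
    (isClassModule_classModUnitsCocycle S hS).invSub H
        (map H.subtype (𝟙 (Rep.res H.subtype (classModUnitsRep F E S))) 2 x) =
      H.index • classModUnitsInv S hS x := by
  rw [(isClassModule_classModUnitsCocycle S hS).invSub_map_subtype H x, inv_classModUnitsCocycle_apply]

/-- **`inv_H (res_H ū_{E/F}) = 1/|H|`.** [cite: SerreLocalFields1979, Ch. XI §3][cite: Neukirch2013, Part II §1 Prop. (1.6) b)] -/
theorem invSub_classModUnits_resFundamentalClassModUnits
    (hS : ∀ v : HeightOneSpectrum (𝓞 F), v ∉ S → Algebra.IsUnramifiedIn (𝓞 E) v.asIdeal)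
    (H : Subgroup (E ≃ₐ[F] E)) :
    (isClassModule_classModUnitsCocycle S hS).invSub H (resFundamentalClassModUnits S H) = oneDiv (Nat.card H) := by
  rw [resFundamentalClassModUnits_eq]
  exact (isClassModule_classModUnitsCocycle S hS).invSub_map_subtype_H2π H

/-- `inv_H (r • res_H ū_{E/F}) = r/|H|`. [cite: SerreLocalFields1979, Ch. XI §3] -/
theorem invSub_classModUnits_zsmul_resFundamentalClassModUnits
    (hS : ∀ v : HeightOneSpectrum (𝓞 F), v ∉ S → Algebra.IsUnramifiedIn (𝓞 E) v.asIdeal)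
    (H : Subgroup (E ≃ₐ[F] E)) (r : ℤ) :
    (isClassModule_classModUnitsCocycle S hS).invSub H (r • resFundamentalClassModUnits S H) =
      r • oneDiv (Nat.card H) := by
  rw [resFundamentalClassModUnits_eq]
  exact (isClassModule_classModUnitsCocycle S hS).invSub_zsmul H r

/-- Every class of `H²(H, C_S(E))` is an integer multiple of `res_H ū_{E/F}`. [cite: SerreLocalFields1979, Ch. XI §3] -/
theorem exists_zsmul_resFundamentalClassModUnits_eq
    (hS : ∀ v : HeightOneSpectrum (𝓞 F), v ∉ S → Algebra.IsUnramifiedIn (𝓞 E) v.asIdeal)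
    (H : Subgroup (E ≃ₐ[F] E)) (y : groupCohomology (Rep.res H.subtype (classModUnitsRep F E S)) 2) :
    ∃ r : ℤ, r • resFundamentalClassModUnits S H = y := by
  rw [resFundamentalClassModUnits_eq]
  exact (isClassModule_classModUnitsCocycle S hS).exists_zsmul_map_subtype_H2π_eq H y

/-- **`inv_H` is injective** on `H²(H, C_S(E))`. [cite: SerreLocalFields1979, Ch. XI §2 Prop. 1] -/
theorem invSub_classModUnits_injective
    (hS : ∀ v : HeightOneSpectrum (𝓞 F), v ∉ S → Algebra.IsUnramifiedIn (𝓞 E) v.asIdeal)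
    (H : Subgroup (E ≃ₐ[F] E)) : Function.Injective ((isClassModule_classModUnitsCocycle S hS).invSub H) :=
  (isClassModule_classModUnitsCocycle S hS).invSub_injective H

/-- **Every `r/|H|` is a value of `inv_H`** (at `r • res_H ū_{E/F}`). [cite: SerreLocalFields1979, Ch. XI §3] -/
theorem exists_invSub_classModUnits_eq
    (hS : ∀ v : HeightOneSpectrum (𝓞 F), v ∉ S → Algebra.IsUnramifiedIn (𝓞 E) v.asIdeal)
    (H : Subgroup (E ≃ₐ[F] E)) (r : ℤ) :
    ∃ y : groupCohomology (Rep.res H.subtype (classModUnitsRep F E S)) 2,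
      (isClassModule_classModUnitsCocycle S hS).invSub H y = r • oneDiv (Nat.card H) :=
  ⟨_, invSub_classModUnits_zsmul_resFundamentalClassModUnits S hS H r⟩

/-- **Restriction commutes with `H²(π)`**: `res_H (H²(π) α) = H²(π|_H) (res_H α)`, i.e. the isomorphisms
`H²(Gal(E/F), C_E) ⥲ H²(Gal(E/F), C_S(E))` and `H²(H, C_E) ⥲ H²(H, C_S(E))` are compatible with restriction (w4 g19's
`map_subtype_map_id_eq`). [cite: Harari2020, §17.1 Thm. 17.2 (proof)] -/
theorem map_subtype_groupCohomologyClassModUnitsIsoTop_hom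
    (hS : ∀ v : HeightOneSpectrum (𝓞 F), v ∉ S → Algebra.IsUnramifiedIn (𝓞 E) v.asIdeal)
    (H : Subgroup (E ≃ₐ[F] E)) (n : ℕ) [NeZero n] (α : groupCohomology (IdeleClassGroup.galoisRep F E) n) :
    map H.subtype (𝟙 (Rep.res H.subtype (classModUnitsRep F E S))) n ((groupCohomologyClassModUnitsIsoTop S hS n).hom α) =
      (groupCohomologyClassModUnitsIso S hS H n).hom
        (map H.subtype (𝟙 (Rep.res H.subtype (IdeleClassGroup.galoisRep F E))) n α) :=
  map_subtype_map_id_eq (C₂ := IdeleClassGroup.galoisRep F E) (A₂ := classModUnitsRep F E S)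
    (cokernel.π (unitsOffToClass (F := F) (E := E) S)) H n α

/-- **Comparison with the relative invariants of `C_E`**: along `H²(H, C_E) ⥲ H²(H, C_S(E))` (`S ⊇ ram`) the relative
`S`-invariant at `H` IS the relative idèle-class invariant at `H`, for ANY class-module structure `φ` of `C_E`
representing `u_{E/F}` (`inv_H` of a class module only depends on `res_H` of its class, and both classes restrict
`u_{E/F}`). [cite: SerreLocalFields1979, Ch. XI §3][cite: Harari2020, §17.1 Thm. 17.2 (proof)] -/
theorem invSub_classModUnits_iso_hom
    (hS : ∀ v : HeightOneSpectrum (𝓞 F), v ∉ S → Algebra.IsUnramifiedIn (𝓞 E) v.asIdeal)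
    {φ : cocycles₂ (IdeleClassGroup.galoisRep F E)} (hφ : IsClassModule (IdeleClassGroup.galoisRep F E) φ)
    (hφu : H2π (IdeleClassGroup.galoisRep F E) φ = fundamentalClassAll F E)
    (H : Subgroup (E ≃ₐ[F] E)) (y : groupCohomology (Rep.res H.subtype (IdeleClassGroup.galoisRep F E)) 2) :
    (isClassModule_classModUnitsCocycle S hS).invSub H ((groupCohomologyClassModUnitsIso S hS H 2).hom y) =
      hφ.invSub H y := by
  -- the composite `inv_H^S ∘ H²(π|_H)` takes the value `1/|H|` on `res_H [φ] = res_H u_{E/F}`, hence is `inv_H`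
  let f : groupCohomology (Rep.res H.subtype (IdeleClassGroup.galoisRep F E)) 2 →+ AddCircle (1 : ℚ) :=
    ((isClassModule_classModUnitsCocycle S hS).invSub H).comp
      (groupCohomologyClassModUnitsIso S hS H 2).hom.hom.toAddMonoidHom
  have hf : f (map H.subtype (𝟙 (Rep.res H.subtype (IdeleClassGroup.galoisRep F E))) 2
      (H2π (IdeleClassGroup.galoisRep F E) φ)) = oneDiv (Nat.card H) := by
    change (isClassModule_classModUnitsCocycle S hS).invSub H ((groupCohomologyClassModUnitsIso S hS H 2).hom
      (map H.subtype (𝟙 (Rep.res H.subtype (IdeleClassGroup.galoisRep F E))) 2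
        (H2π (IdeleClassGroup.galoisRep F E) φ))) = _
    rw [← map_subtype_groupCohomologyClassModUnitsIsoTop_hom S hS H 2, hφu,
      groupCohomologyClassModUnitsIsoTop_hom_fundamentalClassAll]
    exact invSub_classModUnits_resFundamentalClassModUnits S hS H
  exact DFunLike.congr_fun (hφ.eq_invSub_of_apply H f hf) y

/-! ## §4. The ranges in the form `{q : n • q = 0}` (the `P`-class-formation range conditions) -/

/-- Every element of `ℚ/ℤ` killed by `N ≥ 1` is an integer multiple of `1/N`. [folklore] -/
private theorem exists_zsmul_oneDiv_eq_of_nsmul_eq_zero {N : ℕ} (hN : 0 < N) (t : AddCircle (1 : ℚ)) (ht : N • t = 0) :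
    ∃ r : ℤ, r • oneDiv N = t := by
  induction t using QuotientAddGroup.induction_on with
  | H q =>
    have hN' : (N : ℚ) ≠ 0 := Nat.cast_ne_zero.2 hN.ne'
    have h : ((N • q : ℚ) : AddCircle (1 : ℚ)) = 0 := by rw [AddCircle.coe_nsmul]; exact ht
    obtain ⟨m, hm⟩ := (AddCircle.coe_eq_zero_iff (1 : ℚ)).1 h
    rw [zsmul_eq_mul, mul_one, nsmul_eq_mul] at hm
    refine ⟨m, ?_⟩
    rw [zsmul_oneDiv]
    congr 1
    rw [hm, mul_div_cancel_left₀ _ hN']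

/-- `N • (r • (1/N)) = 0` in `ℚ/ℤ`. [folklore] -/
private theorem nsmul_zsmul_oneDiv (N : ℕ) (r : ℤ) : N • (r • oneDiv N) = 0 := by
  rw [smul_comm, nsmul_oneDiv, smul_zero]

/-- **The range of `inv_S` is `{q : [E:F] • q = 0}`** (= `(1/[E:F])ℤ/ℤ`; the form in which the `P`-class-formation
engine reads the layer ranges, w7 g11's `exists_desc_eq_of_pow_nsmul_eq_zero` / `exists_eq_nsmul_of_layers`).
[cite: Harari2020, §16.4 Remark 16.24 (b), §17.1 Thm. 17.2] -/
theorem mem_range_classModUnitsInv_iff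
    (hS : ∀ v : HeightOneSpectrum (𝓞 F), v ∉ S → Algebra.IsUnramifiedIn (𝓞 E) v.asIdeal) (q : AddCircle (1 : ℚ)) :
    q ∈ Set.range (classModUnitsInv S hS) ↔ Module.finrank F E • q = 0 := by
  constructor
  · rintro ⟨x, rfl⟩
    exact finrank_nsmul_classModUnitsInv S hS x
  · intro hq
    obtain ⟨r, rfl⟩ := exists_zsmul_oneDiv_eq_of_nsmul_eq_zero Module.finrank_pos q hq
    exact ⟨r • fundamentalClassModUnits F E S, classModUnitsInv_zsmul_fundamentalClassModUnits S hS r⟩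

/-- **The range of `inv_H` is `{q : |H| • q = 0}`** (= `(1/|H|)ℤ/ℤ`). [cite: Harari2020, §16.4 Remark 16.24 (b)][cite: SerreLocalFields1979, Ch. XI §3] -/
theorem mem_range_invSub_classModUnits_iff
    (hS : ∀ v : HeightOneSpectrum (𝓞 F), v ∉ S → Algebra.IsUnramifiedIn (𝓞 E) v.asIdeal)
    (H : Subgroup (E ≃ₐ[F] E)) (q : AddCircle (1 : ℚ)) :
    q ∈ Set.range ((isClassModule_classModUnitsCocycle S hS).invSub H) ↔ Nat.card H • q = 0 := by
  rw [(isClassModule_classModUnitsCocycle S hS).range_invSub H]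
  constructor
  · rintro ⟨r, rfl⟩
    exact nsmul_zsmul_oneDiv _ r
  · intro hq
    obtain ⟨r, rfl⟩ := exists_zsmul_oneDiv_eq_of_nsmul_eq_zero Nat.card_pos q hq
    exact ⟨r, rfl⟩

end IdeleCohomology

end Literature.NumberTheory.GaloisRepresentations

end
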